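import Mathlib
import HarnessLib
import Summits.ResolutionOfSingularities.ResolutionOfSingularities.Theorems.WildQuotientsWildQuotientResolutionS1aA1Move2Cover
import Summits.ResolutionOfSingularities.ResolutionOfSingularities.Theorems.WildQuotientsWildQuotientResolutionS1aA1ModelPins
import Summits.ResolutionOfSingularities.ResolutionOfSingularities.Theorems.WildQuotientsWildQuotientResolutionS1aChartTransition
import Summits.ResolutionOfSingularities.ResolutionOfSingularities.Theorems.WildQuotientsWildQuotientResolutionS1aNodeCentre
import Summits.ResolutionOfSingularities.ResolutionOfSingularities.Theorems.WildQuotientsWildQuotientResolutionS1aModelNodeAtlas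
import Summits.ResolutionOfSingularities.ResolutionOfSingularities.Theorems.WildQuotientsWildQuotientResolutionS1aKillGlue

/-!
# S1a — INSTANCE I-2 (a1): MOVE 2 OF MT-a1″ over an ABSTRACT model of the node of the norm chart `N(x₁)`

[OURS · L1 W4.5c · lead-1 g13; plan-1 CHAIN v10.40 §4 ASSIGNMENT (ii) «SPLIT `a1_moves12` one theorem per move (consumers may take the node iso as
hypothesis) — never one giant declaration», R-F15c (I-2 := MT-a1″: (x₀:2,x₁:1;δ1) → on N(x₁): (X₀′:2,x₂:1;δ1) → on [X₀′]₂: (s₂:1,Y₂:1,s:2;δ1) = KILL),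
X-CERT v1 §3 a1 move 2] — NOT statements of the manuscript; counted 0; AI-level work, weaker than expert review. Crux stmt-ResolutionOfSingularities-17941
`CyclicQuotientFourfolds`, line `s1a-logminvertex` v13 (`stub_reachLowerInFX`).

Move 2 is stated over an ABSTRACT ring `P` modelling the node `DW` of the stable affine chart `W` (= the norm chart `N(x₁)` of move 1) through a ring
isomorphism `Φ : DW.B ≃+* P`, with the action read as `τ = Φ⁻¹ ≫ DW.σ ≫ Φ` and the a1 ROWS of X-CERT v1 §3 / F13 (`τX₁ = X₁ + X₀s`, `τx₂ = x₂ + s²X₀`,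
`τx₃ = x₃ + sX₁x₂`, `s, X₀, η⁻¹` and a generating set `Gfix` fixed); the model-specific facts (K1′ for `(X₀, x₂)`, `X₁` a unit, characteristic `p`,
generation) are HYPOTHESES, discharged in the assembly from the free model `k[x_none, x′][1/h]` (✓p671712, ✓p671044). No term of this file spells a
free model, so every declaration elaborates in seconds (the monolithic `a1_moves12` of gen 12 did not elaborate within the farm wall).
* `coverRatio_mul_toChartRing` — the chart-transition pin `(c₁/c₀)·y₀ = y₁` in the chart ring `R^w[c₀⁻¹]` (generic);
* ★★★ `GameFrame.GModel.a1_move2` — from the node `(W, DW, Φ, τ)` with the a1 rows, a cover `M₁.V = W ∪ U₀` with a section `t ∈ Γ(M₁, W)` pinned to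
  `X₀^{dp}·η⁻¹` and invertible on `W ∩ U₀` (the killed `[x₀]₂` chart of move 1), and an atlas `𝔄₁` with `F_𝔄₁ ⊆ W`: the (2,1)-centre `(X₀, x₂)` is an
  ADMISSIBLE move `𝒦₂` on `M₁`, and on EVERY realisation `π₂ : M₂ → M₁` there are the producer chart `W₂ = [X₀]₂` (stable affine) and an atlas `𝔄₂` with
  `F_𝔄₂ ⊆ W₂` (the `N₂` chart is KILLED by the unit `X₁·Y₂ ∈ 𝔞₂`), TOGETHER WITH the exposed node of `W₂` for move 3: its pinned node iso `E₂` (tame,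
  `g₀`-intertwining with `sigmaChart`, `E₂(π₂^*x) = toChartRing (e_P x)`), the second chart `W₂′ = N₂`, the cover `M₂.V = W₂ ∪ W₂′ ∪ π₂⁻¹U₀`, and the
  ratio section `u₂ ∈ Γ(M₂, W₂)` (`E₂ u₂ = c₁/c₀`) invertible on `W₂ ∩ W₂′` — the closedness inputs of move 3.
-/

set_option linter.dupNamespace false

noncomputable section

open CategoryTheory Limits AlgebraicGeometry TopologicalSpace Topology Opposite
open Literature.AlgebraicGeometry.Resolution Literature.AlgebraicGeometry.RelativeSpec
open scoped LaurentPolynomial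
open Summit.ResolutionOfSingularities.ResolutionOfSingularities.Theorems.WildQuotientResolution.S1
open Summit.ResolutionOfSingularities.ResolutionOfSingularities.Theorems.WildQuotientResolution.S1.NodeAtlas
open Summit.ResolutionOfSingularities.ResolutionOfSingularities.Theorems.WildQuotientResolution.S1.CoarseChart
open Summit.ResolutionOfSingularities.ResolutionOfSingularities.Theorems.WildQuotientResolution.S1.ProducerStep
open Summit.ResolutionOfSingularities.ResolutionOfSingularities.Theorems.WildQuotientResolution.S1.NpFrame
open Summit.ResolutionOfSingularities.ResolutionOfSingularities.Theorems.WildQuotientResolution.S1.GoodCharts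
open Summit.ResolutionOfSingularities.ResolutionOfSingularities.Theorems.WildQuotientResolution.S1.BlowupCharts
open Summit.ResolutionOfSingularities.ResolutionOfSingularities.Theorems.WildQuotientResolution.S1.KillableTransport
open Summit.ResolutionOfSingularities.ResolutionOfSingularities.Theorems.WildQuotientResolution.S1.KillCert
open Summit.ResolutionOfSingularities.ResolutionOfSingularities.Theorems.WildQuotientResolution.S1.ReesBigrading
open Summit.ResolutionOfSingularities.ResolutionOfSingularities.Theorems.WildQuotientResolution.S1.NodeTransport
open Summit.ResolutionOfSingularities.ResolutionOfSingularities.Theorems.WildQuotientResolution.S1.CobordantTransport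
open Summit.ResolutionOfSingularities.ResolutionOfSingularities.Theorems.WildQuotientResolution.BlowupExit
open Summit.ResolutionOfSingularities.ResolutionOfSingularities.Theorems.WildQuotientResolution.S1.KillGlue

/-! ## The chart-transition pin in a chart ring -/

namespace Summit.ResolutionOfSingularities.ResolutionOfSingularities.Theorems.WildQuotientResolution.S1.CoarseChart

universe u

variable {ι : Type} [AddCommGroup ι] [DecidableEq ι] {B : Type u} [CommRing B] (𝒜 : ι → AddSubgroup B) [GradedRing 𝒜]
  {c : ℕ} (f : Fin c → B) (w : Fin c → ℕ)

/-- **The ratio `c₁/c₀` of two cover elements of one degree `D`, times `y₀`, is `y₁`** in the chart ring `R^w[c₀⁻¹]` (`c_j = y_j T^D`).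
[OURS · L1 W4.5c; folklore] -/
theorem coverRatio_mul_toChartRing (D : ℕ) (y₀ y₁ : ↥(𝒜 0)) (hy₀ : y₀ ∈ (traceFiltration 𝒜 f w).ideal D) (hy₁ : y₁ ∈ (traceFiltration 𝒜 f w).ideal D) :
    (algebraMap _ (ChartRing 𝒜 f w D y₀ hy₀) (coverElement 𝒜 f w D y₁ hy₁) * IsLocalization.Away.invSelf (coverElement 𝒜 f w D y₀ hy₀)) *
        toChartRing 𝒜 f w D y₀ hy₀ y₀ = toChartRing 𝒜 f w D y₀ hy₀ y₁ := by
  have hRw : coverElement 𝒜 f w D y₁ hy₁ * algebraMap B ↥(cobordantAlgebra f w) (y₀ : B) =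
      algebraMap B ↥(cobordantAlgebra f w) (y₁ : B) * coverElement 𝒜 f w D y₀ hy₀ := by
    refine Subtype.ext ?_
    rw [MulMemClass.coe_mul, MulMemClass.coe_mul, cobordantAlgebra.coe_algebraMap, cobordantAlgebra.coe_algebraMap, coe_coverElement, coe_coverElement]
    ring
  change (algebraMap _ (ChartRing 𝒜 f w D y₀ hy₀) (coverElement 𝒜 f w D y₁ hy₁) * IsLocalization.Away.invSelf (coverElement 𝒜 f w D y₀ hy₀)) *
      algebraMap _ (ChartRing 𝒜 f w D y₀ hy₀) (algebraMap B ↥(cobordantAlgebra f w) (y₀ : B)) =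
    algebraMap _ (ChartRing 𝒜 f w D y₀ hy₀) (algebraMap B ↥(cobordantAlgebra f w) (y₁ : B))
  calc (algebraMap _ (ChartRing 𝒜 f w D y₀ hy₀) (coverElement 𝒜 f w D y₁ hy₁) * IsLocalization.Away.invSelf (coverElement 𝒜 f w D y₀ hy₀)) *
        algebraMap _ (ChartRing 𝒜 f w D y₀ hy₀) (algebraMap B ↥(cobordantAlgebra f w) (y₀ : B))
      = algebraMap _ (ChartRing 𝒜 f w D y₀ hy₀) (coverElement 𝒜 f w D y₁ hy₁ * algebraMap B ↥(cobordantAlgebra f w) (y₀ : B)) *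
          IsLocalization.Away.invSelf (coverElement 𝒜 f w D y₀ hy₀) := by rw [map_mul]; ring
    _ = algebraMap _ (ChartRing 𝒜 f w D y₀ hy₀) (algebraMap B ↥(cobordantAlgebra f w) (y₁ : B)) *
          (algebraMap _ (ChartRing 𝒜 f w D y₀ hy₀) (coverElement 𝒜 f w D y₀ hy₀) * IsLocalization.Away.invSelf (coverElement 𝒜 f w D y₀ hy₀)) := by
        rw [hRw, map_mul]; ring
    _ = algebraMap _ (ChartRing 𝒜 f w D y₀ hy₀) (algebraMap B ↥(cobordantAlgebra f w) (y₁ : B)) := by rw [IsLocalization.Away.mul_invSelf, mul_one]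

end Summit.ResolutionOfSingularities.ResolutionOfSingularities.Theorems.WildQuotientResolution.S1.CoarseChart

/-! ## Move 2 of MT-a1″ -/

namespace Summit.ResolutionOfSingularities.ResolutionOfSingularities.Theorems.WildQuotientResolution.S1.GameFrame.GModel

open MvPolynomial

variable {p : ℕ} {X' X₁ : Scheme.{0}} {q : X' ⟶ X₁} {G : Type} [Group G] {ρ : G →* Aut X'} {g₀ : G}

set_option maxHeartbeats 1600000 in
/-- ★★★ **MOVE 2 OF MT-a1″ (abstract model of the node of `N(x₁)`), with the exposed node of the residual chart `[X₀]₂`.** See the module docstring.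
[OURS · L1 W4.5c · R-F15c I-2, move 2 of 3; NOT a statement of the manuscript] -/
theorem a1_move2 [Finite G] [NeZero p] (hp : p.Prime) (hG : ∀ g : G, g ∈ Subgroup.zpowers g₀)
    (M₁ : GModel p q G ρ g₀) [M₁.V.IsSeparated] (W : M₁.act.StableAffineOpens) (DW : NodeData p M₁.act g₀ W)
    {P : Type} [CommRing P] [CharP P p] (Φ : letI := DW.instCommRing; DW.B ≃+* P) (τ : P ≃+* P)
    (hτ : letI := DW.instCommRing; ∀ x : P, τ x = Φ (DW.σ (Φ.symm x)))
    -- generators of the model and the rows of `τ`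
    (s X₀ X₁ x₂ x₃ η ηinv : P) (Gfix : Set P)
    (hs : τ s = s) (hX₀ : τ X₀ = X₀) (hX₁ : τ X₁ = X₁ + X₀ * s) (hx₂ : τ x₂ = x₂ + s ^ 2 * X₀) (hx₃ : τ x₃ = x₃ + s * X₁ * x₂)
    (hηinv : τ ηinv = ηinv) (hηη : η * ηinv = 1)
    (hfix : ∀ g ∈ Gfix, τ g = g) (hgen : Subring.closure (({s, X₀, X₁, x₂, x₃} : Set P) ∪ Gfix) = ⊤) (hX₁u : IsUnit X₁)
    -- degrees of the generators in the transported grading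
    (θ : Π j : Fin DW.m, ZMod (DW.r j)) (d : ℕ) (hd : 0 < d)
    (hX₀d : letI := DW.instCommRing; letI := DW.instGradedRing; X₀ ∈ mapGrading DW.𝒜 Φ (2 • θ))
    (hx₂d : letI := DW.instCommRing; letI := DW.instGradedRing; x₂ ∈ mapGrading DW.𝒜 Φ 0)
    (hsd : letI := DW.instCommRing; letI := DW.instGradedRing; s ∈ mapGrading DW.𝒜 Φ (-θ))
    (hηinvd : letI := DW.instCommRing; letI := DW.instGradedRing; ηinv ∈ mapGrading DW.𝒜 Φ (-((d * (2 * p)) • θ)))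
    -- K1′ for the centre `(X₀, x₂)`
    (hK1 : RingTheory.Sequence.IsRegular P (List.ofFn (![X₀, x₂] : Fin 2 → P)))
    (hK1' : IsRegularRing (P ⧸ Ideal.span (Set.range (![X₀, x₂] : Fin 2 → P))))
    -- the closedness datum on `M₁`
    (U₀ : M₁.V.Opens) (hcov : ∀ x : M₁.V, x ∈ W.1 ∨ x ∈ U₀) (t : Γ(M₁.V, W.1))
    (ht : letI := DW.instCommRing; letI := DW.instGradedRing; Φ ((DW.e t : ↥(DW.𝒜 0)) : DW.B) = X₀ ^ (d * p) * ηinv)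
    (htU : ∀ v ∈ W.1, v ∈ U₀ → v ∈ M₁.V.basicOpen t)
    (𝔄₁ : NodeAtlasData p M₁.act g₀) (hF₁ : 𝔄₁.fLocus ⊆ (W.1 : Set M₁.V)) :
    letI := DW.instCommRing; letI := DW.instGradedRing; letI := mapGradedRing DW.𝒜 Φ
    ∃ (𝒦₂ : ReesFiltration M₁.V) (d₂ : ℕ), 0 < d₂ ∧ IsAdmissibleCentre p M₁.act g₀ 𝒦₂ d₂ ∧
      ∀ (M₂ : GModel p q G ρ g₀) (π₂ : M₂.V ⟶ M₁.V), IsBlowup π₂ (𝒦₂.ideal d₂) → M₂.r = π₂ ≫ M₁.r →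
        (∀ g : G, (M₂.act.aut g).hom ≫ π₂ = π₂ ≫ (M₁.act.aut g).hom) →
        ∃ (W₂ : M₂.act.StableAffineOpens) (𝔄₂ : NodeAtlasData p M₂.act g₀) (_ : 𝔄₂.fLocus ⊆ (W₂.1 : Set M₂.V))
          (_ : IsAffineOpen W₂.1) (hle : W₂.1 ≤ π₂ ⁻¹ᵁ W.1)
          -- the exposed node of `W₂ = [X₀]₂`
          (hf₂ : ∀ i, (![X₀, x₂] : Fin 2 → P) i ∈ mapGrading DW.𝒜 Φ ((![2 • θ, 0] : Fin 2 → Π j : Fin DW.m, ZMod (DW.r j)) i))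
          (hσJ₂ : ∀ n : ℕ, ((weightedFiltration (![X₀, x₂] : Fin 2 → P) ![2, 1]).ideal n).map (τ : P →+* P) ≤
            (weightedFiltration (![X₀, x₂] : Fin 2 → P) ![2, 1]).ideal n)
          (hσp : ∀ x : P, (⇑τ)^[p] x = x)
          (y₀ : ↥(mapGrading DW.𝒜 Φ 0)) (_ : (y₀ : P) = (X₀ ^ (d * p) * ηinv) ^ d₂)
          (hy₀ : y₀ ∈ (traceFiltration (mapGrading DW.𝒜 Φ) (![X₀, x₂] : Fin 2 → P) ![2, 1]).ideal (d₂ * (d * (2 * p))))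
          (hσy₀ : τ (y₀ : P) = y₀)
          (c₁ : ↥(cobordantAlgebra (![X₀, x₂] : Fin 2 → P) ![2, 1]))
          (_ : (c₁ : P[T;T⁻¹]) = LaurentPolynomial.C ((∏ i : ZMod p, (x₂ + (i.val : P) * (s ^ 2 * X₀))) ^ (2 * d * d₂)) *
            LaurentPolynomial.T (((d₂ * (d * (2 * p)) : ℕ)) : ℤ))
          (E₂ : letI := chartNodeGradedRing DW.r (mapGrading DW.𝒜 Φ) (![X₀, x₂] : Fin 2 → P) ![2, 1] hf₂ (d₂ * (d * (2 * p))) y₀ hy₀;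
            Γ(M₂.V, W₂.1) ≃+* ↥(chartNodeGrading DW.r (mapGrading DW.𝒜 Φ) (![X₀, x₂] : Fin 2 → P) ![2, 1] hf₂ (d₂ * (d * (2 * p))) y₀ hy₀ 0))
          (W₂' : M₂.V.Opens) (u₂ : Γ(M₂.V, W₂.1)),
          letI := chartNodeGradedRing DW.r (mapGrading DW.𝒜 Φ) (![X₀, x₂] : Fin 2 → P) ![2, 1] hf₂ (d₂ * (d * (2 * p))) y₀ hy₀
          IsTameNode p (ChartRing (mapGrading DW.𝒜 Φ) (![X₀, x₂] : Fin 2 → P) ![2, 1] (d₂ * (d * (2 * p))) y₀ hy₀)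
              (chartNodeGrading DW.r (mapGrading DW.𝒜 Φ) (![X₀, x₂] : Fin 2 → P) ![2, 1] hf₂ (d₂ * (d * (2 * p))) y₀ hy₀)
              (sigmaChart (mapGrading DW.𝒜 Φ) (![X₀, x₂] : Fin 2 → P) ![2, 1] (d₂ * (d * (2 * p))) y₀ hy₀ τ hσJ₂ hp.pos hσp hσy₀) ∧
            (∀ t' : Γ(M₂.V, W₂.1),
              ((E₂ ((M₂.act.aut g₀⁻¹).hom.appLE W₂.1 W₂.1 (W₂.2.1 g₀⁻¹).ge t') :
                  ↥(chartNodeGrading DW.r (mapGrading DW.𝒜 Φ) (![X₀, x₂] : Fin 2 → P) ![2, 1] hf₂ (d₂ * (d * (2 * p))) y₀ hy₀ 0)) :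
                  ChartRing (mapGrading DW.𝒜 Φ) (![X₀, x₂] : Fin 2 → P) ![2, 1] (d₂ * (d * (2 * p))) y₀ hy₀) =
                sigmaChart (mapGrading DW.𝒜 Φ) (![X₀, x₂] : Fin 2 → P) ![2, 1] (d₂ * (d * (2 * p))) y₀ hy₀ τ hσJ₂ hp.pos hσp hσy₀
                  ((E₂ t' : ↥(chartNodeGrading DW.r (mapGrading DW.𝒜 Φ) (![X₀, x₂] : Fin 2 → P) ![2, 1] hf₂ (d₂ * (d * (2 * p))) y₀ hy₀ 0)) :
                    ChartRing (mapGrading DW.𝒜 Φ) (![X₀, x₂] : Fin 2 → P) ![2, 1] (d₂ * (d * (2 * p))) y₀ hy₀)) ∧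
            (∀ x : Γ(M₁.V, W.1),
              ((E₂ (π₂.appLE W.1 W₂.1 hle x) :
                  ↥(chartNodeGrading DW.r (mapGrading DW.𝒜 Φ) (![X₀, x₂] : Fin 2 → P) ![2, 1] hf₂ (d₂ * (d * (2 * p))) y₀ hy₀ 0)) :
                  ChartRing (mapGrading DW.𝒜 Φ) (![X₀, x₂] : Fin 2 → P) ![2, 1] (d₂ * (d * (2 * p))) y₀ hy₀) =
                toChartRing (mapGrading DW.𝒜 Φ) (![X₀, x₂] : Fin 2 → P) ![2, 1] (d₂ * (d * (2 * p))) y₀ hy₀ ((DW.e.trans (zeroRingEquiv DW.𝒜 Φ)) x)) ∧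
            (∀ x : M₂.V, x ∈ W₂.1 ∨ x ∈ W₂' ∨ π₂.base x ∈ U₀) ∧
            ((E₂ u₂ : ↥(chartNodeGrading DW.r (mapGrading DW.𝒜 Φ) (![X₀, x₂] : Fin 2 → P) ![2, 1] hf₂ (d₂ * (d * (2 * p))) y₀ hy₀ 0)) :
                ChartRing (mapGrading DW.𝒜 Φ) (![X₀, x₂] : Fin 2 → P) ![2, 1] (d₂ * (d * (2 * p))) y₀ hy₀) =
              algebraMap _ (ChartRing (mapGrading DW.𝒜 Φ) (![X₀, x₂] : Fin 2 → P) ![2, 1] (d₂ * (d * (2 * p))) y₀ hy₀) c₁ *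
                IsLocalization.Away.invSelf (coverElement (mapGrading DW.𝒜 Φ) (![X₀, x₂] : Fin 2 → P) ![2, 1] (d₂ * (d * (2 * p))) y₀ hy₀) ∧
            (∀ v ∈ W₂.1, v ∈ W₂' → v ∈ M₂.V.basicOpen u₂) := by
  classical
  letI := DW.instCommRing
  letI := DW.instGradedRing
  letI := mapGradedRing DW.𝒜 Φ
  have hp1 : p ≠ 1 := hp.one_lt.ne'
  have hdp : 0 < d * p := Nat.mul_pos hd hp.pos
  have hdbar : 0 < d * (2 * p) := Nat.mul_pos hd (Nat.mul_pos two_pos hp.pos)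
  have hw : ∀ i, 0 < (![2, 1] : Fin 2 → ℕ) i := fun i => by fin_cases i <;> norm_num
  -- the transported node, read through `τ`
  have hτeq : (conj Φ DW.σ : P ≃+* P) = τ := RingEquiv.ext fun x => (hτ x).symm
  have htameτ : IsTameNode p P (mapGrading DW.𝒜 Φ) τ := hτeq ▸ isTameNode_map DW.𝒜 Φ p DW.σ DW.tame
  have hσp : ∀ x : P, (⇑τ)^[p] x = x := htameτ.2.2.2.2.2
  have hσL : ∀ t' : Γ(M₁.V, W.1), (((DW.e.trans (zeroRingEquiv DW.𝒜 Φ)) ((M₁.act.aut g₀⁻¹).hom.appLE W.1 W.1 (W.2.1 g₀⁻¹).ge t') :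
      ↥(mapGrading DW.𝒜 Φ 0)) : P) = τ (((DW.e.trans (zeroRingEquiv DW.𝒜 Φ)) t' : ↥(mapGrading DW.𝒜 Φ 0)) : P) := fun t' => by
    change Φ ((DW.e (actO M₁.act W g₀ t') : ↥(DW.𝒜 0)) : DW.B) = τ (Φ ((DW.e t' : ↥(DW.𝒜 0)) : DW.B))
    rw [DW.intertwine t', hτ, Φ.symm_apply_apply]
  have hf₂ := A1.a1m2_hf X₀ x₂ DW.r (mapGrading DW.𝒜 Φ) θ hX₀d hx₂d
  have hσJ₂ := A1.a1m2_map_le τ s X₀ X₁ x₂ x₃ Gfix hs hX₀ hX₁ hx₂ hx₃ hfix hgen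
  have hσJc : ∀ n : ℕ, ((weightedFiltration (![X₀, x₂] : Fin 2 → P) ![2, 1]).ideal n).map (conj Φ DW.σ : P →+* P) ≤
      (weightedFiltration (![X₀, x₂] : Fin 2 → P) ![2, 1]).ideal n := by rw [hτeq]; exact hσJ₂
  -- the value of the pinned section in the model and the closedness of the traces
  have ht' : (((DW.e.trans (zeroRingEquiv DW.𝒜 Φ)) t : ↥(mapGrading DW.𝒜 Φ 0)) : P) = X₀ ^ (d * p) * ηinv := ht
  have hmemJ : ∀ n : ℕ, (X₀ ^ (d * p) * ηinv) ^ n ∈ (weightedFiltration (![X₀, x₂] : Fin 2 → P) ![2, 1]).ideal n := by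
    intro n
    have h1 : X₀ ^ (d * p) * ηinv ∈ (weightedFiltration (![X₀, x₂] : Fin 2 → P) ![2, 1]).ideal 1 :=
      Ideal.mul_mem_right _ _ (Ideal.pow_mem_of_mem _ ((weightedFiltration (![X₀, x₂] : Fin 2 → P) ![2, 1]).antitone (by norm_num : 1 ≤ 2)
        (mem_weightedFiltration_ideal (![X₀, x₂] : Fin 2 → P) ![2, 1] 0)) _ hdp)
    have h := Ideal.pow_mem_pow h1 n
    have hle := Veronese.idealFiltration_pow_le (weightedFiltration (![X₀, x₂] : Fin 2 → P) ![2, 1]) 1 n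
    rw [one_mul] at hle
    exact hle h
  have hcl₂ : ∀ n : ℕ, 0 < n →
      closure (M₁.V.zeroLocus (U := W.1)
          ((((traceFiltration (mapGrading DW.𝒜 Φ) (![X₀, x₂] : Fin 2 → P) ![2, 1]).ideal n).comap
              ((DW.e.trans (zeroRingEquiv DW.𝒜 Φ) : Γ(M₁.V, W.1) ≃+* ↥(mapGrading DW.𝒜 Φ 0)) : Γ(M₁.V, W.1) →+* ↥(mapGrading DW.𝒜 Φ 0)) :
            Ideal Γ(M₁.V, W.1)) : Set Γ(M₁.V, W.1)) ∩ (W.1 : Set M₁.V)) ⊆ (W.1 : Set M₁.V) := by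
    intro n hn
    refine closure_zeroLocus_inter_subset_of_cover W.1 (fun _ : Unit => U₀) (fun x => (hcov x).imp_right fun h => ⟨(), h⟩) _ (fun _ => t)
      (fun _ => ⟨n, hn, ?_⟩) (fun _ v hvW hvU => htU v hvW hvU)
    change (DW.e.trans (zeroRingEquiv DW.𝒜 Φ)) (t ^ n) ∈ (traceFiltration (mapGrading DW.𝒜 Φ) (![X₀, x₂] : Fin 2 → P) ![2, 1]).ideal n
    rw [mem_traceFiltration_iff, map_pow, SetLike.GradeZero.coe_pow, ht']
    exact hmemJ n
  -- ### the centre of move 2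
  obtain ⟨𝒦₂, d₂, hd₂, hadm₂, -, hG𝒦₂, h𝒦₂O, hver₂, hsupp₂⟩ := exists_isAdmissibleCentre_of_node hG M₁ W DW Φ two_pos (![X₀, x₂] : Fin 2 → P)
    (![2 • θ, 0]) ![2, 1] hw hf₂ hK1 hK1' hσJc hcl₂
  refine ⟨𝒦₂, d₂, hd₂, hadm₂, fun M₂ π₂ hbl₂ hr₂ hcomm₂ => ?_⟩
  -- ### the realisation `M₂`: cover, (H1), residual, atlas
  have hdeg0 : (X₀ ^ (d * p) * ηinv) ^ d₂ ∈ mapGrading DW.𝒜 Φ 0 := A1.a1m2_cover_zero_deg X₀ ηinv d d₂ DW.r (mapGrading DW.𝒜 Φ) θ hX₀d hηinvd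
  have hdeg1 : (∏ i : ZMod p, (x₂ + (i.val : P) * (s ^ 2 * X₀))) ^ (2 * d * d₂) ∈ mapGrading DW.𝒜 Φ 0 := by
    have h := SetLike.pow_mem_graded (2 * d * d₂) (A1.a1m2_norm_deg (p := p) s X₀ x₂ DW.r (mapGrading DW.𝒜 Φ) θ hX₀d hx₂d hsd)
    rwa [smul_zero] at h
  obtain ⟨y', hy'0, hy'1⟩ : ∃ y' : Fin 2 → ↥(mapGrading DW.𝒜 Φ 0), y' 0 = ⟨_, hdeg0⟩ ∧ y' 1 = ⟨_, hdeg1⟩ := ⟨![⟨_, hdeg0⟩, ⟨_, hdeg1⟩], rfl, rfl⟩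
  have hy'v0 : ((y' 0 : ↥(mapGrading DW.𝒜 Φ 0)) : P) = (X₀ ^ (d * p) * ηinv) ^ d₂ := congrArg Subtype.val hy'0
  have hy'v1 : ((y' 1 : ↥(mapGrading DW.𝒜 Φ 0)) : P) = (∏ i : ZMod p, (x₂ + (i.val : P) * (s ^ 2 * X₀))) ^ (2 * d * d₂) := congrArg Subtype.val hy'1
  have hy' : ∀ j, y' j ∈ (traceFiltration (mapGrading DW.𝒜 Φ) (![X₀, x₂] : Fin 2 → P) ![2, 1]).ideal (d₂ * (d * (2 * p))) := by
    intro j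
    rw [mem_traceFiltration_iff]
    fin_cases j
    · exact (congrArg (fun x : P => x ∈ (weightedFiltration (![X₀, x₂] : Fin 2 → P) ![2, 1]).ideal (d₂ * (d * (2 * p)))) hy'v0).mpr
        (A1.a1m2_cover_zero_mem X₀ x₂ ηinv d d₂)
    · exact (congrArg (fun x : P => x ∈ (weightedFiltration (![X₀, x₂] : Fin 2 → P) ![2, 1]).ideal (d₂ * (d * (2 * p)))) hy'v1).mpr
        (A1.a1m2_cover_one_mem s X₀ x₂ d d₂)
  have hσy' : ∀ j, τ (y' j : P) = y' j := by
    intro j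
    fin_cases j
    · exact (congrArg τ hy'v0).trans ((A1.a1m2_cover_zero_fixed τ X₀ ηinv hX₀ hηinv d d₂).trans hy'v0.symm)
    · exact (congrArg τ hy'v1).trans ((A1.a1m2_cover_one_fixed τ s X₀ x₂ hs hX₀ hx₂ d d₂ hp1).trans hy'v1.symm)
  have hc0' : ((coverElement (mapGrading DW.𝒜 Φ) (![X₀, x₂] : Fin 2 → P) ![2, 1] (d₂ * (d * (2 * p))) (y' 0) (hy' 0) :
      ↥(cobordantAlgebra (![X₀, x₂] : Fin 2 → P) ![2, 1])) : P[T;T⁻¹]) =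
      LaurentPolynomial.C ((X₀ ^ (d * p) * ηinv) ^ d₂) * LaurentPolynomial.T (((d₂ * (d * (2 * p)) : ℕ)) : ℤ) :=
    (coe_coverElement (mapGrading DW.𝒜 Φ) (![X₀, x₂] : Fin 2 → P) ![2, 1] (d₂ * (d * (2 * p))) (y' 0) (hy' 0)).trans
      (congrArg (fun x : P => LaurentPolynomial.C x * LaurentPolynomial.T (((d₂ * (d * (2 * p)) : ℕ)) : ℤ)) hy'v0)
  have hc1' : ((coverElement (mapGrading DW.𝒜 Φ) (![X₀, x₂] : Fin 2 → P) ![2, 1] (d₂ * (d * (2 * p))) (y' 1) (hy' 1) :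
      ↥(cobordantAlgebra (![X₀, x₂] : Fin 2 → P) ![2, 1])) : P[T;T⁻¹]) =
      LaurentPolynomial.C ((∏ i : ZMod p, (x₂ + (i.val : P) * (s ^ 2 * X₀))) ^ (2 * d * d₂)) * LaurentPolynomial.T (((d₂ * (d * (2 * p)) : ℕ)) : ℤ) :=
    (coe_coverElement (mapGrading DW.𝒜 Φ) (![X₀, x₂] : Fin 2 → P) ![2, 1] (d₂ * (d * (2 * p))) (y' 1) (hy' 1)).trans
      (congrArg (fun x : P => LaurentPolynomial.C x * LaurentPolynomial.T (((d₂ * (d * (2 * p)) : ℕ)) : ℤ)) hy'v1)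
  have hrad' : ∀ i : Fin 2, cobordantAlgebra.u' (![X₀, x₂] : Fin 2 → P) ![2, 1] i ∈
      (Ideal.span (Set.range fun j => coverElement (mapGrading DW.𝒜 Φ) (![X₀, x₂] : Fin 2 → P) ![2, 1] (d₂ * (d * (2 * p))) (y' j) (hy' j))).radical := by
    intro i
    have h := A1.a1m2_hrad s X₀ x₂ η ηinv hηη d d₂ (coverElement (mapGrading DW.𝒜 Φ) (![X₀, x₂] : Fin 2 → P) ![2, 1] (d₂ * (d * (2 * p))) (y' 0) (hy' 0))
      (coverElement (mapGrading DW.𝒜 Φ) (![X₀, x₂] : Fin 2 → P) ![2, 1] (d₂ * (d * (2 * p))) (y' 1) (hy' 1)) hc0' hc1' i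
    refine Ideal.radical_mono (Ideal.span_mono ?_) h
    exact Set.insert_subset_iff.mpr ⟨⟨0, rfl⟩, Set.singleton_subset_iff.mpr ⟨1, rfl⟩⟩
  -- (H1) and the residual ideal `𝔞₂ ∋ X₁ Y₂`
  have hH1 := A1.a1m2_augmentationIdeal_sigmaR_le τ s X₀ X₁ x₂ x₃ Gfix hs hX₀ hX₁ hx₂ hx₃ hfix hgen hp.pos hσp
  obtain ⟨-, hres2, hres3⟩ := A1.a1m2_residual_mem τ s X₀ X₁ x₂ x₃ Gfix hs hX₀ hX₁ hx₂ hx₃ hfix hgen hp.pos hσp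
  have hY₂mem : cobordantAlgebra.u' (![X₀, x₂] : Fin 2 → P) ![2, 1] 1 ∈
      (augmentationIdeal (sigmaR τ (![X₀, x₂] : Fin 2 → P) ![2, 1] hσJ₂ hp.pos hσp)).colon
        (Ideal.span {algebraMap P ↥(cobordantAlgebra (![X₀, x₂] : Fin 2 → P) ![2, 1]) s * cobordantAlgebra.s (![X₀, x₂] : Fin 2 → P) ![2, 1]}) :=
    (Ideal.unit_mul_mem_iff_mem _ (hX₁u.map (algebraMap P ↥(cobordantAlgebra (![X₀, x₂] : Fin 2 → P) ![2, 1])))).mp hres3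
  -- the second cover element lies in `𝔞₂` (every factor of the norm does)
  have hc1prod := A1.a1m2_coverElement_one_eq s X₀ x₂ d d₂
    (coverElement (mapGrading DW.𝒜 Φ) (![X₀, x₂] : Fin 2 → P) ![2, 1] (d₂ * (d * (2 * p))) (y' 1) (hy' 1)) hc1'
  have hfac : ∀ j : ZMod p, cobordantAlgebra.u' (![X₀, x₂] : Fin 2 → P) ![2, 1] 1 +
      algebraMap P ↥(cobordantAlgebra (![X₀, x₂] : Fin 2 → P) ![2, 1]) ((j.val : P) * s ^ 2) *
        (cobordantAlgebra.s (![X₀, x₂] : Fin 2 → P) ![2, 1] * cobordantAlgebra.u' (![X₀, x₂] : Fin 2 → P) ![2, 1] 0) ∈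
      (augmentationIdeal (sigmaR τ (![X₀, x₂] : Fin 2 → P) ![2, 1] hσJ₂ hp.pos hσp)).colon
        (Ideal.span {algebraMap P ↥(cobordantAlgebra (![X₀, x₂] : Fin 2 → P) ![2, 1]) s * cobordantAlgebra.s (![X₀, x₂] : Fin 2 → P) ![2, 1]}) := by
    intro j
    refine add_mem hY₂mem (Ideal.mul_mem_left _ _ ?_)
    have h := hres2
    rw [mul_comm (cobordantAlgebra.u' (![X₀, x₂] : Fin 2 → P) ![2, 1] 0)] at h
    exact h
  have hprodmem : (∏ j : ZMod p, (cobordantAlgebra.u' (![X₀, x₂] : Fin 2 → P) ![2, 1] 1 +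
      algebraMap P ↥(cobordantAlgebra (![X₀, x₂] : Fin 2 → P) ![2, 1]) ((j.val : P) * s ^ 2) *
        (cobordantAlgebra.s (![X₀, x₂] : Fin 2 → P) ![2, 1] * cobordantAlgebra.u' (![X₀, x₂] : Fin 2 → P) ![2, 1] 0))) ∈
      (augmentationIdeal (sigmaR τ (![X₀, x₂] : Fin 2 → P) ![2, 1] hσJ₂ hp.pos hσp)).colon
        (Ideal.span {algebraMap P ↥(cobordantAlgebra (![X₀, x₂] : Fin 2 → P) ![2, 1]) s * cobordantAlgebra.s (![X₀, x₂] : Fin 2 → P) ![2, 1]}) := by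
    rw [← Finset.mul_prod_erase Finset.univ _ (Finset.mem_univ (0 : ZMod p))]
    exact Ideal.mul_mem_right _ _ (hfac 0)
  have hc1mem : coverElement (mapGrading DW.𝒜 Φ) (![X₀, x₂] : Fin 2 → P) ![2, 1] (d₂ * (d * (2 * p))) (y' 1) (hy' 1) ∈
      (augmentationIdeal (sigmaR τ (![X₀, x₂] : Fin 2 → P) ![2, 1] hσJ₂ hp.pos hσp)).colon
        (Ideal.span {algebraMap P ↥(cobordantAlgebra (![X₀, x₂] : Fin 2 → P) ![2, 1]) s * cobordantAlgebra.s (![X₀, x₂] : Fin 2 → P) ![2, 1]}) := by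
    rw [hc1prod]
    exact Ideal.pow_mem_of_mem _ hprodmem _ (Nat.mul_pos (Nat.mul_pos two_pos hd) hd₂)
  -- the atlas of move 2
  obtain ⟨OW₂, hOW₂aff, hOW₂eq, E₂, htame₂, hE₂, hpin₂, 𝔄₂, hF₂⟩ := exists_moveAtlas_of_node hp.pos hG M₁ M₂ 𝔄₁ W DW.affine
    DW.r (mapGrading DW.𝒜 Φ) (![X₀, x₂] : Fin 2 → P) ![2, 1] hf₂ τ (DW.e.trans (zeroRingEquiv DW.𝒜 Φ)) htameτ hσp hσL hw hK1 hK1' hσJ₂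
    𝒦₂ d₂ hG𝒦₂ h𝒦₂O hver₂ hsupp₂ π₂ hbl₂ hr₂ hcomm₂ hdbar y' hy' hσy' hrad'
    (algebraMap P ↥(cobordantAlgebra (![X₀, x₂] : Fin 2 → P) ![2, 1]) s * cobordantAlgebra.s (![X₀, x₂] : Fin 2 → P) ![2, 1]) hH1 (fun _ => 1)
    (fun j => ![algebraMap _ (ChartRing (mapGrading DW.𝒜 Φ) (![X₀, x₂] : Fin 2 → P) ![2, 1] (d₂ * (d * (2 * p))) (y' j) (hy' j))
        (coverElement (mapGrading DW.𝒜 Φ) (![X₀, x₂] : Fin 2 → P) ![2, 1] (d₂ * (d * (2 * p))) (y' 1) (hy' 1)) *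
      IsLocalization.Away.invSelf (coverElement (mapGrading DW.𝒜 Φ) (![X₀, x₂] : Fin 2 → P) ![2, 1] (d₂ * (d * (2 * p))) (y' j) (hy' j))])
    (fun j l => by
      fin_cases l
      exact residualSection_mem_chartNodeGrading_zero DW.r (mapGrading DW.𝒜 Φ) (![X₀, x₂] : Fin 2 → P) ![2, 1] hf₂ (y' j) (hy' j)
        (coverElement_mem_reesPiece (mapGrading DW.𝒜 Φ) (![X₀, x₂] : Fin 2 → P) ![2, 1] (d₂ * (d * (2 * p))) (y' 1) (hy' 1)))
    (fun j l => by
      fin_cases l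
      exact residualSection_mem_map DW.r (mapGrading DW.𝒜 Φ) (![X₀, x₂] : Fin 2 → P) ![2, 1] (y' j) (hy' j) hc1mem)
  have hWle : ∀ j, (OW₂ j).1 ≤ π₂ ⁻¹ᵁ W.1 := fun j => by rw [hOW₂eq j]; exact blowupChart_le_preimage π₂ _ ⟨W.1, DW.affine⟩ _
  -- the `N₂` chart is killed: its residual section is `1`
  have hz1W : ∀ v ∈ (OW₂ 1).1, v ∈ M₂.V.basicOpen
      (letI := chartNodeGradedRing DW.r (mapGrading DW.𝒜 Φ) (![X₀, x₂] : Fin 2 → P) ![2, 1] hf₂ (d₂ * (d * (2 * p))) (y' 1) (hy' 1);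
        (E₂ 1).symm ⟨_, residualSection_mem_chartNodeGrading_zero DW.r (mapGrading DW.𝒜 Φ) (![X₀, x₂] : Fin 2 → P) ![2, 1] hf₂ (y' 1) (hy' 1)
          (coverElement_mem_reesPiece (mapGrading DW.𝒜 Φ) (![X₀, x₂] : Fin 2 → P) ![2, 1] (d₂ * (d * (2 * p))) (y' 1) (hy' 1))⟩) := fun v hv => by
    letI := chartNodeGradedRing DW.r (mapGrading DW.𝒜 Φ) (![X₀, x₂] : Fin 2 → P) ![2, 1] hf₂ (d₂ * (d * (2 * p))) (y' 1) (hy' 1)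
    have h1 : (⟨_, residualSection_mem_chartNodeGrading_zero DW.r (mapGrading DW.𝒜 Φ) (![X₀, x₂] : Fin 2 → P) ![2, 1] hf₂ (y' 1) (hy' 1)
          (coverElement_mem_reesPiece (mapGrading DW.𝒜 Φ) (![X₀, x₂] : Fin 2 → P) ![2, 1] (d₂ * (d * (2 * p))) (y' 1) (hy' 1))⟩ :
        ↥((chartNodeGrading DW.r (mapGrading DW.𝒜 Φ) (![X₀, x₂] : Fin 2 → P) ![2, 1] hf₂ (d₂ * (d * (2 * p))) (y' 1) (hy' 1)) 0)) = 1 :=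
      Subtype.ext (IsLocalization.Away.mul_invSelf _)
    rw [h1, map_one, Scheme.basicOpen_of_isUnit _ isUnit_one]
    exact hv
  have hF₂W : 𝔄₂.fLocus ⊆ ((OW₂ 0).1 : Set M₂.V) := by
    intro v hv
    rcases hF₂ hv with hold | hnew
    · exact absurd (hF₁ hold.1) hold.2
    · obtain ⟨j, hvW, hvR⟩ := Set.mem_iUnion.mp hnew
      revert hvW hvR
      refine Fin.cases ?_ (fun j' => Fin.cases ?_ (fun j'' => j''.elim0) j') j
      · intro hvW _
        exact hvW
      · intro hvW hvR
        exact absurd (hz1W v hvW) (hvR 0)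
  -- ### the exposed node of `W₂ = OW₂ 0`: cover of `M₂.V` and the ratio section
  have hπ' : IsBlowup π₂ ((𝒦₂.ideal d₂) ^ (d * (2 * p))) := isBlowup_pow hbl₂ hdbar.ne'
  have hverbar := CoarseChart.veroneseNormalised_mul (mapGrading DW.𝒜 Φ) _ _ hver₂ hdbar
  have hJ' : ((𝒦₂.ideal d₂) ^ (d * (2 * p))).ideal ⟨W.1, DW.affine⟩ =
      ((traceFiltration (mapGrading DW.𝒜 Φ) (![X₀, x₂] : Fin 2 → P) ![2, 1]).ideal (d₂ * (d * (2 * p)))).comap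
        ((DW.e.trans (zeroRingEquiv DW.𝒜 Φ) : Γ(M₁.V, W.1) ≃+* ↥(mapGrading DW.𝒜 Φ 0)) : Γ(M₁.V, W.1) →+* ↥(mapGrading DW.𝒜 Φ 0)) := by
    rw [Scheme.IdealSheafData.ideal_pow, Pi.pow_apply, ← ReesFiltration.filtration_ideal, h𝒦₂O d₂, hver₂.2 (d * (2 * p)), comap_equiv_pow]
  have hxJ0 : (DW.e.trans (zeroRingEquiv DW.𝒜 Φ)).symm (y' 0) ∈ ((𝒦₂.ideal d₂) ^ (d * (2 * p))).ideal ⟨W.1, DW.affine⟩ := by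
    rw [hJ', Ideal.mem_comap, RingHom.coe_coe, RingEquiv.apply_symm_apply]; exact hy' 0
  have hcov₂ : ∀ x : M₂.V, x ∈ (OW₂ 0).1 ∨ x ∈ (OW₂ 1).1 ∨ π₂.base x ∈ U₀ := by
    intro x
    rcases hcov (π₂.base x) with hxW | hxU
    · have hcovW := iSup_blowupChart_eq_preimage (I := 𝒦₂.ideal d₂) M₁.act DW.r (mapGrading DW.𝒜 Φ) (![X₀, x₂] : Fin 2 → P) ![2, 1] hf₂
        W DW.affine (DW.e.trans (zeroRingEquiv DW.𝒜 Φ)) hπ' hverbar hJ' y' hy' hrad'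
      have hx : x ∈ ⨆ j, blowupChart π₂ ((𝒦₂.ideal d₂) ^ (d * (2 * p))) ⟨W.1, DW.affine⟩ ((DW.e.trans (zeroRingEquiv DW.𝒜 Φ)).symm (y' j)) :=
        (congrArg (fun U : M₂.V.Opens => x ∈ U) hcovW).mpr hxW
      obtain ⟨j, hj⟩ := Opens.mem_iSup.mp hx
      revert hj
      refine Fin.cases ?_ (fun j' => Fin.cases ?_ (fun j'' => j''.elim0) j') j
      · intro hj; exact Or.inl ((congrArg (fun U : M₂.V.Opens => x ∈ U) (hOW₂eq 0)).mpr hj)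
      · intro hj; exact Or.inr (Or.inl ((congrArg (fun U : M₂.V.Opens => x ∈ U) (hOW₂eq 1)).mpr hj))
    · exact Or.inr (Or.inr hxU)
  -- the ratio section `u₂ = E₂⁻¹(c₁/c₀)` on `W₂` and its pin
  letI inst0 := chartNodeGradedRing DW.r (mapGrading DW.𝒜 Φ) (![X₀, x₂] : Fin 2 → P) ![2, 1] hf₂ (d₂ * (d * (2 * p))) (y' 0) (hy' 0)
  have hz0mem := residualSection_mem_chartNodeGrading_zero DW.r (mapGrading DW.𝒜 Φ) (![X₀, x₂] : Fin 2 → P) ![2, 1] hf₂ (y' 0) (hy' 0)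
    (coverElement_mem_reesPiece (mapGrading DW.𝒜 Φ) (![X₀, x₂] : Fin 2 → P) ![2, 1] (d₂ * (d * (2 * p))) (y' 1) (hy' 1))
  have hpz : (E₂ 0).symm ⟨_, hz0mem⟩ * π₂.appLE W.1 (OW₂ 0).1 (hWle 0) ((DW.e.trans (zeroRingEquiv DW.𝒜 Φ)).symm (y' 0)) =
      π₂.appLE W.1 (OW₂ 0).1 (hWle 0) ((DW.e.trans (zeroRingEquiv DW.𝒜 Φ)).symm (y' 1)) :=
    symm_mul_appLE_eq_of_pin π₂ W.1 (OW₂ 0).1 (hWle 0)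
      (chartNodeGrading DW.r (mapGrading DW.𝒜 Φ) (![X₀, x₂] : Fin 2 → P) ![2, 1] hf₂ (d₂ * (d * (2 * p))) (y' 0) (hy' 0)) (E₂ 0)
      (DW.e.trans (zeroRingEquiv DW.𝒜 Φ)) (toChartRing (mapGrading DW.𝒜 Φ) (![X₀, x₂] : Fin 2 → P) ![2, 1] (d₂ * (d * (2 * p))) (y' 0) (hy' 0))
      (hpin₂ 0 (hWle 0)) ⟨_, hz0mem⟩ _ _ (y' 1) (y' 0) (RingEquiv.apply_symm_apply _ _) (RingEquiv.apply_symm_apply _ _)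
      (coverRatio_mul_toChartRing (mapGrading DW.𝒜 Φ) (![X₀, x₂] : Fin 2 → P) ![2, 1] (d₂ * (d * (2 * p))) (y' 0) (y' 1) (hy' 0) (hy' 1))
  have hu₂ : ∀ v ∈ (OW₂ 0).1, v ∈ (OW₂ 1).1 → v ∈ M₂.V.basicOpen ((E₂ 0).symm ⟨_, hz0mem⟩) := fun v hv0 hv1 =>
    mem_basicOpen_of_mem_blowupChart_of_mul_appLE_eq hπ' ⟨W.1, DW.affine⟩ hxJ0 (le_of_eq (hOW₂eq 0)) _ hpz hv0
      ((congrArg (fun U : M₂.V.Opens => v ∈ U) (hOW₂eq 1)).mp hv1)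
  refine ⟨OW₂ 0, 𝔄₂, hF₂W, hOW₂aff 0, hWle 0, hf₂, hσJ₂, hσp, y' 0, hy'v0, hy' 0, hσy' 0,
    coverElement (mapGrading DW.𝒜 Φ) (![X₀, x₂] : Fin 2 → P) ![2, 1] (d₂ * (d * (2 * p))) (y' 1) (hy' 1), hc1', E₂ 0, (OW₂ 1).1,
    (E₂ 0).symm ⟨_, hz0mem⟩, htame₂ 0, hE₂ 0, hpin₂ 0 (hWle 0), hcov₂, ?_, hu₂⟩
  rw [(E₂ 0).apply_symm_apply]

end Summit.ResolutionOfSingularities.ResolutionOfSingularities.Theorems.WildQuotientResolution.S1.GameFrame.GModel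

end
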